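import Literature.MathematicalPhysics.QuantumManyBody.PeriodicBoseGas
import Mathlib.Analysis.Calculus.MeanValue
import Mathlib.Analysis.Calculus.FDeriv.Mul
import Mathlib.Analysis.Calculus.FDeriv.Measurable
import Mathlib.Analysis.Calculus.ContDiff.Operations
import Mathlib.Analysis.Calculus.Deriv.Inv
import Mathlib.Analysis.SpecialFunctions.Log.Deriv
import Mathlib.Analysis.Complex.RealDeriv
import Mathlib.LinearAlgebra.StdBasis
import HarnessLib

/-!
# Relative Fisher information of two `N`-body wave functions

Topic `Literature/MathematicalPhysics/QuantumManyBody` (definition item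
`defn-relativeFisherInformation`, wanted by route `BECRelativeFisher` of the conjunct
`BoseEinsteinCondensation` of the summit `AtomisticToContinuum`, and usable by the sibling routes
`BECParentHamiltonian`, `BECConditionalEntropy`).

## The notion

For two measures `μ ≪ ν` on a Riemannian configuration space with density `f = dμ/dν`, the
**relative Fisher information** of `μ` with respect to `ν` is
`I(μ|ν) = I_ν(f) = ∫ |∇f|²/f dν = 4 ∫ |∇√f|² dν = ∫ |∇ log f|² dμ`
[RezakhanlouVillani2008, Part I (C. Villani), §1.3.1 "Conventions", p. 15; OttoVillani2000, §1].
It is the entropy production functional of the Fokker–Planck / Witten-Laplacian flow with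
invariant measure `ν` and the right-hand side of the logarithmic Sobolev inequality
`H(μ|ν) ≤ (2ρ)⁻¹ I(μ|ν)` [RezakhanlouVillani2008, §1.3.2 (3)].

Here the two measures are the position densities of two **real** `N`-body wave functions on
`Config N = (ℝ³)^N`: `dP = Ψ_P² dX`, `dQ = Ψ_Q² dX` with `Ψ_Q` non-vanishing, so that
`f = Ψ_P²/Ψ_Q² = h²` with `h = Ψ_P/Ψ_Q` and

`I(P‖Q) = 4 ∫ |∇(Ψ_P/Ψ_Q)|² Ψ_Q² dX = ∫ |∇ log(Ψ_P²/Ψ_Q²)|² Ψ_P² dX`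

(all `3N` partial derivatives). This is the quantity behind the **ground-state representation**
(ground-state transformation of Albeverio–Høegh-Krohn–Streit; LSSY's substitution `Ψ = F · Ψ₀`):
if `Ψ₀ > 0` is an exact ground state of `H = -∑Δᵢ + V` with energy `E₀`, then for real `Φ = h Ψ₀`
`⟨Φ, (H - E₀) Φ⟩ = ∫ |∇h|² Ψ₀² = ¼ I(P_Φ‖P_Ψ₀)` [LSSY2005, (6.26)–(6.28);
AlbeverioHoeghkrohnStreit1977].

## Contents

* `partialRelFisherDensity i Ψ_P Ψ_Q X = 4 |∇ᵢ(Ψ_P/Ψ_Q)(X)|² Ψ_Q(X)²` — the density of the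
  relative Fisher information carried by particle `i` (`∇ᵢ` = gradient in `xᵢ ∈ ℝ³`, written as
  the sum over the three coordinate directions `e_{i,k}` of squared partial derivatives, the
  convention of `kineticDensity`);
* `relFisherDensity Ψ_P Ψ_Q X = 4 |∇(Ψ_P/Ψ_Q)(X)|² Ψ_Q(X)² = ∑ᵢ partialRelFisherDensity i …`;
* `relativeFisherInformation S Ψ_P Ψ_Q = I_S(P‖Q) = ∫_S relFisherDensity` — the relative Fisher
  information **on a region** `S ⊆ (ℝ³)^N`: `S = Set.univ` for wave functions on the whole space
  (Dirichlet states extended by zero live there), `S = cellN N L` (the fundamental cell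
  `[0,L)^{3N}`) for periodic states on the torus of side `L`;
* `partialRelativeFisherInformation i S Ψ_P Ψ_Q = ∫_S partialRelFisherDensity i` — the
  per-particle version (only `∇_{xᵢ}`), so that `I_S = ∑ᵢ I_S^{(i)}`
  (`relativeFisherInformation_eq_sum`);
* basic API: scaling (`I(cP‖Q) = c² I(P‖Q)`, `I(P‖cQ) = I(P‖Q)` for `c ≠ 0`), vanishing for
  `Ψ_P = c Ψ_Q`, and the characterisation `I_S(P‖Q) = 0 ↔ Ψ_P = c Ψ_Q on S` for `C¹` amplitudes
  on an open connected region (`relativeFisherInformation_eq_zero_iff`); the logarithmic form of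
  the density (`relFisherDensity_eq_log`); the bridge to `kineticDensity` of the complexified ratio
  (`relFisherDensity_eq_kineticDensity`, the shape used by route `BECParentHamiltonian`) and the
  unfolded form `I_S = 4 ∫_S (∑ᵢ ∑ₖ |∂_{i,k}(Ψ_P/Ψ_Q)|²) Ψ_Q²`
  (`relativeFisherInformation_re_eq_four_mul_lintegral`, literally `4 ×` the integral in item
  `GroundStateRepresentation` of route `BECRelativeFisher`, whose conclusion therefore reads
  `periodicEnergy v Φ = E₀^per + ¼ I_{cell}(P_Φ‖P_Ψ₀)`).

## Design choices

* Values in `ℝ≥0∞` (lower Lebesgue integrals of a non-negative density), like `kineticDensity`,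
  `energy`, `periodicEnergy`: `I ≥ 0` is automatic and `I = ⊤` is allowed (e.g. hard cores).
* Real amplitudes `Ψ_P, Ψ_Q : Config N → ℝ` (the measures are `Ψ² dX`); for a complex `Ψ` the
  weighted form `∫ |∇(Ψ/Ψ_Q)|² Ψ_Q²` also contains the phase-gradient energy and only dominates
  `¼ I(P_{|Ψ|}‖Q)` (diamagnetic inequality), so it is not given this name.
* The ratio `Ψ_P/Ψ_Q` uses Lean's `x / 0 = 0`; all statements that need it assume `Ψ_Q ≠ 0`
  (on the region). Where the ratio is not differentiable `fderiv = 0` (Mathlib's convention), as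
  in `kineticDensity`.
* The squared gradient is the coordinate sum `∑ᵢ ∑ₖ |∂_{i,k} h|²`, i.e. the Euclidean norm of the
  gradient on `(ℝ³)^N`; the operator norm of `fderiv` for the sup-norm Pi type `Config N` would be
  the wrong (`ℓ¹`) norm, which is why no abstract normed-space version is offered.

## Not here

The abstract measure-theoretic functional `I(μ|ν)` for arbitrary measures (it needs `W^{1,1}_loc`
densities and is not what the requesting routes quantify over); the ground-state representation
identity itself (a statement item of route `BECRelativeFisher`, problem side); logarithmic Sobolev
/ HWI inequalities [OttoVillani2000] (only the definition is requested).

## References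

* [RezakhanlouVillani2008] F. Rezakhanlou, C. Villani, *Entropy Methods for the Boltzmann
  Equation*, LNM 1916, Springer 2008 — Part I (Villani), §1.3.1, p. 15: `I_ν(f) = ∫ |∇f|²/f dν`,
  `I(μ|ν) = I_ν(dμ/dν)`; §1.3.2: log-Sobolev inequality `∫ h² log h² M ≤ 2 ∫ |∇h|² M + …`.
* [OttoVillani2000] F. Otto, C. Villani, *Generalization of an inequality by Talagrand and links
  with the logarithmic Sobolev inequality*, J. Funct. Anal. 173 (2000) 361–400, §1.
* [LSSY2005] E. H. Lieb, R. Seiringer, J. P. Solovej, J. Yngvason, *The Mathematics of the Bose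
  Gas and its Condensation*, Birkhäuser 2005, (6.26)–(6.28) (substitution `Ψ = F ∏φ^GP`,
  `⟨Ψ|HΨ⟩/⟨Ψ|Ψ⟩ - E = … + ∑ᵢ ∫ ∏ρ |∇ᵢF|² / ∫ ∏ρ |F|²`).
* [AlbeverioHoeghkrohnStreit1977] S. Albeverio, R. Høegh-Krohn, L. Streit, *Energy forms,
  Hamiltonians, and distorted Brownian paths*, J. Math. Phys. 18 (1977) 907–917.
-/

noncomputable section

open MeasureTheory Set Filter
open scoped ENNReal NNReal Topology

namespace Literature.MathematicalPhysics.QuantumManyBody.BoseGas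

variable {N : ℕ}

/-! ### Definitions -/

/-- The density of relative Fisher information carried by particle `i`:
`4 |∇ᵢ(Ψ_P/Ψ_Q)(X)|² Ψ_Q(X)² = 4 ∑ₖ |∂_{i,k}(Ψ_P/Ψ_Q)(X)|² Ψ_Q(X)²` (gradient in the variable
`xᵢ ∈ ℝ³` only), for real `N`-body amplitudes `Ψ_P, Ψ_Q` (position densities `Ψ_P² dX`,
`Ψ_Q² dX`). [cite: RezakhanlouVillani2008, Part I §1.3.1 p. 15] -/
def partialRelFisherDensity (i : Fin N) (ΨP ΨQ : Config N → ℝ) (X : Config N) : ℝ≥0∞ :=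
  4 * (∑ k : Fin 3, (‖fderiv ℝ (fun Y => ΨP Y / ΨQ Y) X
      (Pi.single i (EuclideanSpace.single k (1 : ℝ)))‖₊ : ℝ≥0∞) ^ 2) * ENNReal.ofReal (ΨQ X ^ 2)

/-- The density of relative Fisher information `4 |∇(Ψ_P/Ψ_Q)(X)|² Ψ_Q(X)²` of the position
density `Ψ_P² dX` with respect to `Ψ_Q² dX` (all `3N` partial derivatives): with `f = Ψ_P²/Ψ_Q²`
this is `|∇f|²/f · Ψ_Q² = |∇ log f|² Ψ_P²` wherever `Ψ_P Ψ_Q ≠ 0` (`relFisherDensity_eq_log`).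
[cite: RezakhanlouVillani2008, Part I §1.3.1 p. 15] -/
def relFisherDensity (ΨP ΨQ : Config N → ℝ) (X : Config N) : ℝ≥0∞ :=
  4 * (∑ i : Fin N, ∑ k : Fin 3, (‖fderiv ℝ (fun Y => ΨP Y / ΨQ Y) X
      (Pi.single i (EuclideanSpace.single k (1 : ℝ)))‖₊ : ℝ≥0∞) ^ 2) * ENNReal.ofReal (ΨQ X ^ 2)

/-- **Relative Fisher information** `I_S(P‖Q) = 4 ∫_S |∇(Ψ_P/Ψ_Q)|² Ψ_Q² dX ∈ [0, ∞]` of the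
position density `P = Ψ_P² dX` with respect to `Q = Ψ_Q² dX` on the region `S ⊆ (ℝ³)^N`, for real
`N`-body amplitudes (`= ∫_S |∇ log(dP/dQ)|² dP = I(P|Q)` of Otto–Villani for `Ψ_Q ≠ 0` on `S`).
Take `S = Set.univ` for wave functions on `ℝ^{3N}` (Dirichlet states extended by zero) and
`S = cellN N L` for `L`-periodic states on the torus. [cite: RezakhanlouVillani2008, Part I §1.3.1 p. 15] -/
def relativeFisherInformation (S : Set (Config N)) (ΨP ΨQ : Config N → ℝ) : ℝ≥0∞ :=
  ∫⁻ X in S, relFisherDensity ΨP ΨQ X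

/-- The **per-particle relative Fisher information** `I_S^{(i)}(P‖Q) = 4 ∫_S |∇ᵢ(Ψ_P/Ψ_Q)|² Ψ_Q²`
(only the gradient in `xᵢ`); `I_S = ∑ᵢ I_S^{(i)}` (`relativeFisherInformation_eq_sum`), and for
permutation-symmetric amplitudes all `I^{(i)}` coincide. [cite: RezakhanlouVillani2008, Part I §1.3.1 p. 15] -/
def partialRelativeFisherInformation (i : Fin N) (S : Set (Config N)) (ΨP ΨQ : Config N → ℝ) :
    ℝ≥0∞ :=
  ∫⁻ X in S, partialRelFisherDensity i ΨP ΨQ X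

/-! ### Unfolding, sums, measurability -/

/-- `4|∇h|²Ψ_Q² = ∑ᵢ 4|∇ᵢh|²Ψ_Q²`. [folklore] -/
theorem relFisherDensity_eq_sum (ΨP ΨQ : Config N → ℝ) (X : Config N) :
    relFisherDensity ΨP ΨQ X = ∑ i, partialRelFisherDensity i ΨP ΨQ X := by
  simp only [relFisherDensity, partialRelFisherDensity, Finset.mul_sum, Finset.sum_mul]

/-- The per-particle density is dominated by the total density. [folklore] -/
theorem partialRelFisherDensity_le (i : Fin N) (ΨP ΨQ : Config N → ℝ) (X : Config N) :
    partialRelFisherDensity i ΨP ΨQ X ≤ relFisherDensity ΨP ΨQ X := by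
  rw [relFisherDensity_eq_sum]
  exact Finset.single_le_sum (f := fun j => partialRelFisherDensity j ΨP ΨQ X)
    (fun _ _ => zero_le) (Finset.mem_univ i)

/-- The per-particle density is measurable as soon as `Ψ_Q` is (`fderiv` is always measurable).
[folklore] -/
theorem measurable_partialRelFisherDensity (i : Fin N) (ΨP : Config N → ℝ) {ΨQ : Config N → ℝ}
    (hQ : Measurable ΨQ) : Measurable (partialRelFisherDensity i ΨP ΨQ) := by
  unfold partialRelFisherDensity
  refine ((Finset.measurable_sum _ fun k _ => ?_).const_mul _).mul
    (ENNReal.measurable_ofReal.comp (hQ.pow_const 2))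
  exact ((measurable_fderiv_apply_const ℝ _ _).nnnorm.coe_nnreal_ennreal).pow_const _

/-- The density is measurable as soon as `Ψ_Q` is. [folklore] -/
theorem measurable_relFisherDensity (ΨP : Config N → ℝ) {ΨQ : Config N → ℝ} (hQ : Measurable ΨQ) :
    Measurable (relFisherDensity ΨP ΨQ) := by
  have : relFisherDensity ΨP ΨQ = fun X => ∑ i, partialRelFisherDensity i ΨP ΨQ X :=
    funext fun X => relFisherDensity_eq_sum ΨP ΨQ X
  rw [this]
  exact Finset.measurable_sum _ fun i _ => measurable_partialRelFisherDensity i ΨP hQ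

/-- `I_S(P‖Q) = ∑ᵢ I_S^{(i)}(P‖Q)`. [folklore] -/
theorem relativeFisherInformation_eq_sum (S : Set (Config N)) (ΨP : Config N → ℝ)
    {ΨQ : Config N → ℝ} (hQ : Measurable ΨQ) :
    relativeFisherInformation S ΨP ΨQ = ∑ i, partialRelativeFisherInformation i S ΨP ΨQ := by
  unfold relativeFisherInformation partialRelativeFisherInformation
  rw [← lintegral_finsetSum _ fun i _ => measurable_partialRelFisherDensity i ΨP hQ]
  exact lintegral_congr fun X => relFisherDensity_eq_sum ΨP ΨQ X

/-- `I_S^{(i)} ≤ I_S`. [folklore] -/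
theorem partialRelativeFisherInformation_le (i : Fin N) (S : Set (Config N))
    (ΨP ΨQ : Config N → ℝ) :
    partialRelativeFisherInformation i S ΨP ΨQ ≤ relativeFisherInformation S ΨP ΨQ :=
  lintegral_mono fun X => partialRelFisherDensity_le i ΨP ΨQ X

/-- `I_S ≤ I_T` for `S ⊆ T`. [folklore] -/
theorem relativeFisherInformation_mono {S T : Set (Config N)} (h : S ⊆ T) (ΨP ΨQ : Config N → ℝ) :
    relativeFisherInformation S ΨP ΨQ ≤ relativeFisherInformation T ΨP ΨQ :=
  lintegral_mono_set h

/-- Unfolded form: `I_S(P‖Q) = 4 ∫_S (∑ᵢ ∑ₖ |∂_{i,k}(Ψ_P/Ψ_Q)|²) Ψ_Q² dX`. [folklore] -/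
theorem relativeFisherInformation_eq_four_mul_lintegral (S : Set (Config N))
    (ΨP ΨQ : Config N → ℝ) :
    relativeFisherInformation S ΨP ΨQ =
      4 * ∫⁻ X in S, (∑ i : Fin N, ∑ k : Fin 3, (‖fderiv ℝ (fun Y => ΨP Y / ΨQ Y) X
        (Pi.single i (EuclideanSpace.single k (1 : ℝ)))‖₊ : ℝ≥0∞) ^ 2) *
          ENNReal.ofReal (ΨQ X ^ 2) := by
  rw [relativeFisherInformation, ← lintegral_const_mul' _ _ ENNReal.ofNat_ne_top]
  simp only [relFisherDensity, mul_assoc]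

/-- **Ground-state-representation shape.** For complex wave functions `Φ, Ψ₀` with real values
(`Φ = Re Φ`, `Ψ₀ = Re Ψ₀ > 0`), `¼ I_S(P_Φ‖P_Ψ₀)` is the weighted Dirichlet form
`∫_S |∇(Re Φ/Re Ψ₀)|² (Re Ψ₀)²` — literally the integral in the ground-state representation
`⟨Φ,(H - E₀)Φ⟩ = ∫ |∇(Φ/Ψ₀)|² Ψ₀²` (LSSY's substitution `Ψ = F Ψ₀`; item `GroundStateRepresentation`
of route `BECRelativeFisher` with `S = cellN N L`). [cite: LSSY2005, (6.26)–(6.28)] -/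
theorem relativeFisherInformation_re_eq_four_mul_lintegral (S : Set (Config N))
    (Φ Ψ₀ : Config N → ℂ) :
    relativeFisherInformation S (fun Y => (Φ Y).re) (fun Y => (Ψ₀ Y).re) =
      4 * ∫⁻ X in S, (∑ i : Fin N, ∑ k : Fin 3, (‖fderiv ℝ (fun Y => (Φ Y).re / (Ψ₀ Y).re) X
        (Pi.single i (EuclideanSpace.single k (1 : ℝ)))‖₊ : ℝ≥0∞) ^ 2) *
          ENNReal.ofReal ((Ψ₀ X).re ^ 2) :=
  relativeFisherInformation_eq_four_mul_lintegral S _ _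

/-! ### Bridge to `kineticDensity` -/

/-- Complexifying a real function does not change the size of its partial derivatives:
`‖D(Y ↦ (f Y : ℂ))(X) V‖ = ‖Df(X) V‖` (both vanish where `f` is not differentiable). [folklore] -/
theorem nnnorm_fderiv_ofReal_comp_apply (f : Config N → ℝ) (X V : Config N) :
    ‖fderiv ℝ (fun Y => ((f Y : ℝ) : ℂ)) X V‖₊ = ‖fderiv ℝ f X V‖₊ := by
  by_cases hf : DifferentiableAt ℝ f X
  · have h1 : fderiv ℝ (fun Y => ((f Y : ℝ) : ℂ)) X = Complex.ofRealCLM.comp (fderiv ℝ f X) :=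
      (Complex.ofRealCLM.hasFDerivAt.comp X hf.hasFDerivAt).fderiv
    rw [h1, ContinuousLinearMap.comp_apply, Complex.ofRealCLM_apply, Complex.nnnorm_real]
  · have hf' : ¬DifferentiableAt ℝ (fun Y => ((f Y : ℝ) : ℂ)) X := by
      intro h
      apply hf
      have := Complex.reCLM.differentiableAt.comp X h
      simpa [Function.comp_def] using this
    rw [fderiv_zero_of_not_differentiableAt hf, fderiv_zero_of_not_differentiableAt hf']
    simp

/-- `4|∇(Ψ_P/Ψ_Q)|²Ψ_Q² = 4 · kineticDensity(Ψ_P/Ψ_Q, complexified) · Ψ_Q²` — the weighted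
kinetic-energy form `∫ Ψ_Q² |∇(Ψ/Ψ_Q)|²` in which route `BECParentHamiltonian` states its
parent-energy proximity. [folklore] -/
theorem relFisherDensity_eq_kineticDensity (ΨP ΨQ : Config N → ℝ) (X : Config N) :
    relFisherDensity ΨP ΨQ X =
      4 * kineticDensity (fun Y => ((ΨP Y / ΨQ Y : ℝ) : ℂ)) X * ENNReal.ofReal (ΨQ X ^ 2) := by
  simp only [relFisherDensity, kineticDensity, nnnorm_fderiv_ofReal_comp_apply]

/-! ### Scaling -/

/-- `I`-density is quadratic in `Ψ_P`: `4|∇(cΨ_P/Ψ_Q)|²Ψ_Q² = c² · 4|∇(Ψ_P/Ψ_Q)|²Ψ_Q²`. [folklore] -/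
theorem relFisherDensity_const_mul_left (c : ℝ) (ΨP ΨQ : Config N → ℝ) (X : Config N) :
    relFisherDensity (fun Y => c * ΨP Y) ΨQ X = ENNReal.ofReal (c ^ 2) * relFisherDensity ΨP ΨQ X := by
  have hfun : (fun Y => c * ΨP Y / ΨQ Y) = c • fun Y => ΨP Y / ΨQ Y := by
    funext Y
    simp only [Pi.smul_apply, smul_eq_mul, mul_div_assoc]
  have hc2 : ((‖c‖₊ : ℝ≥0∞)) ^ 2 = ENNReal.ofReal (c ^ 2) := by
    rw [← enorm_eq_nnnorm, Real.enorm_eq_ofReal_abs, ← ENNReal.ofReal_pow (abs_nonneg _), sq_abs]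
  simp only [relFisherDensity]
  rw [hfun, fderiv_const_smul_field]
  simp only [Pi.smul_apply, smul_apply, smul_eq_mul, nnnorm_mul, ENNReal.coe_mul,
    mul_pow, ← Finset.mul_sum, hc2]
  ring

/-- `I`-density is invariant under scaling `Ψ_Q` (`c ≠ 0`): `4|∇(Ψ_P/(cΨ_Q))|²(cΨ_Q)² =
4|∇(Ψ_P/Ψ_Q)|²Ψ_Q²` — `I(P‖Q)` depends on `Q` only through the normalised measure. [folklore] -/
theorem relFisherDensity_const_mul_right {c : ℝ} (hc : c ≠ 0) (ΨP ΨQ : Config N → ℝ)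
    (X : Config N) :
    relFisherDensity ΨP (fun Y => c * ΨQ Y) X = relFisherDensity ΨP ΨQ X := by
  have hfun : (fun Y => ΨP Y / (c * ΨQ Y)) = c⁻¹ • fun Y => ΨP Y / ΨQ Y := by
    funext Y
    simp only [Pi.smul_apply, smul_eq_mul]
    ring
  have hc2 : ((‖c⁻¹‖₊ : ℝ≥0∞)) ^ 2 = ENNReal.ofReal ((c ^ 2)⁻¹) := by
    rw [← enorm_eq_nnnorm, Real.enorm_eq_ofReal_abs, ← ENNReal.ofReal_pow (abs_nonneg _), sq_abs,
      inv_pow]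
  have hcc : ENNReal.ofReal ((c ^ 2)⁻¹) * ENNReal.ofReal (c ^ 2) = 1 := by
    rw [← ENNReal.ofReal_mul (inv_nonneg.mpr (sq_nonneg c)), inv_mul_cancel₀ (pow_ne_zero 2 hc),
      ENNReal.ofReal_one]
  simp only [relFisherDensity]
  rw [hfun, fderiv_const_smul_field]
  simp only [Pi.smul_apply, smul_apply, smul_eq_mul, nnnorm_mul, ENNReal.coe_mul,
    mul_pow, ← Finset.mul_sum, hc2, ENNReal.ofReal_mul (sq_nonneg c)]
  calc 4 * (ENNReal.ofReal ((c ^ 2)⁻¹) * ∑ i : Fin N, ∑ k : Fin 3,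
        ((‖fderiv ℝ (fun Y => ΨP Y / ΨQ Y) X (Pi.single i (EuclideanSpace.single k (1 : ℝ)))‖₊ :
          ℝ≥0∞)) ^ 2) * (ENNReal.ofReal (c ^ 2) * ENNReal.ofReal (ΨQ X ^ 2))
        = ENNReal.ofReal ((c ^ 2)⁻¹) * ENNReal.ofReal (c ^ 2) * (4 * (∑ i : Fin N, ∑ k : Fin 3,
          ((‖fderiv ℝ (fun Y => ΨP Y / ΨQ Y) X (Pi.single i (EuclideanSpace.single k (1 : ℝ)))‖₊ :
            ℝ≥0∞)) ^ 2) * ENNReal.ofReal (ΨQ X ^ 2)) := by ring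
    _ = _ := by rw [hcc, one_mul]

/-- `I_S(cP‖Q) = c² I_S(P‖Q)` (amplitude `cΨ_P`). [folklore] -/
theorem relativeFisherInformation_const_mul_left (S : Set (Config N)) (c : ℝ)
    (ΨP ΨQ : Config N → ℝ) :
    relativeFisherInformation S (fun Y => c * ΨP Y) ΨQ =
      ENNReal.ofReal (c ^ 2) * relativeFisherInformation S ΨP ΨQ := by
  unfold relativeFisherInformation
  rw [← lintegral_const_mul' _ _ ENNReal.ofReal_ne_top]
  exact lintegral_congr fun X => relFisherDensity_const_mul_left c ΨP ΨQ X

/-- `I_S(P‖Q)` is unchanged when the reference amplitude is rescaled, `Ψ_Q ↦ cΨ_Q`, `c ≠ 0`.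
[folklore] -/
theorem relativeFisherInformation_const_mul_right (S : Set (Config N)) {c : ℝ} (hc : c ≠ 0)
    (ΨP ΨQ : Config N → ℝ) :
    relativeFisherInformation S ΨP (fun Y => c * ΨQ Y) = relativeFisherInformation S ΨP ΨQ :=
  lintegral_congr fun X => relFisherDensity_const_mul_right hc ΨP ΨQ X

/-! ### Vanishing: `I(P‖Q) = 0 ↔ Ψ_P = c Ψ_Q` -/

/-- If `Ψ_P = c Ψ_Q` everywhere (`Ψ_Q` non-vanishing) the density vanishes identically. [folklore] -/
theorem relFisherDensity_of_eq_const_mul {ΨP ΨQ : Config N → ℝ} {c : ℝ} (h : ∀ X, ΨP X = c * ΨQ X)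
    (hQ : ∀ X, ΨQ X ≠ 0) (X : Config N) : relFisherDensity ΨP ΨQ X = 0 := by
  have hc : (fun Y => ΨP Y / ΨQ Y) = fun _ => c := funext fun Y => by
    rw [h Y, mul_div_assoc, div_self (hQ Y), mul_one]
  simp [relFisherDensity, hc]

/-- If `Ψ_P = c Ψ_Q` on an open region `S` on which `Ψ_Q ≠ 0`, the density vanishes on `S`.
[folklore] -/
theorem relFisherDensity_eq_zero_of_eqOn {S : Set (Config N)} (hS : IsOpen S) {ΨP ΨQ : Config N → ℝ}
    {c : ℝ} (h : ∀ X ∈ S, ΨP X = c * ΨQ X) (hQ : ∀ X ∈ S, ΨQ X ≠ 0) {X : Config N} (hX : X ∈ S) :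
    relFisherDensity ΨP ΨQ X = 0 := by
  have hloc : (fun Y => ΨP Y / ΨQ Y) =ᶠ[𝓝 X] fun _ => c := by
    filter_upwards [hS.mem_nhds hX] with Y hY
    rw [h Y hY, mul_div_assoc, div_self (hQ Y hY), mul_one]
  simp [relFisherDensity, hloc.fderiv_eq]

/-- `I_S(Q‖Q) = 0`, and more generally `I_S(P‖Q) = 0` whenever `Ψ_P = c Ψ_Q` (everywhere,
`Ψ_Q` non-vanishing). [folklore] -/
theorem relativeFisherInformation_of_eq_const_mul (S : Set (Config N)) {ΨP ΨQ : Config N → ℝ}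
    {c : ℝ} (h : ∀ X, ΨP X = c * ΨQ X) (hQ : ∀ X, ΨQ X ≠ 0) :
    relativeFisherInformation S ΨP ΨQ = 0 := by
  simp [relativeFisherInformation, relFisherDensity_of_eq_const_mul h hQ]

/-- `I_S(Q‖Q) = 0` for a non-vanishing reference amplitude. [folklore] -/
theorem relativeFisherInformation_self (S : Set (Config N)) {ΨQ : Config N → ℝ}
    (hQ : ∀ X, ΨQ X ≠ 0) : relativeFisherInformation S ΨQ ΨQ = 0 :=
  relativeFisherInformation_of_eq_const_mul S (c := 1) (fun _ => (one_mul _).symm) hQ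

/-- On an open region: `Ψ_P = c Ψ_Q` on `S` (`Ψ_Q ≠ 0` on `S`) implies `I_S(P‖Q) = 0`. [folklore] -/
theorem relativeFisherInformation_eq_zero_of_eqOn {S : Set (Config N)} (hS : IsOpen S)
    {ΨP ΨQ : Config N → ℝ} {c : ℝ} (h : ∀ X ∈ S, ΨP X = c * ΨQ X) (hQ : ∀ X ∈ S, ΨQ X ≠ 0) :
    relativeFisherInformation S ΨP ΨQ = 0 := by
  unfold relativeFisherInformation
  rw [setLIntegral_congr_fun hS.measurableSet (g := fun _ => 0)
    (fun X hX => relFisherDensity_eq_zero_of_eqOn hS h hQ hX)]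
  simp

/-- A continuous linear functional on `(ℝ³)^N` vanishing on all coordinate directions `e_{i,k}`
vanishes. [folklore] -/
theorem clm_eq_zero_of_apply_single_eq_zero (A : Config N →L[ℝ] ℝ)
    (h : ∀ (i : Fin N) (k : Fin 3), A (Pi.single i (EuclideanSpace.single k (1 : ℝ))) = 0) :
    A = 0 := by
  classical
  apply ContinuousLinearMap.coe_injective
  refine (Pi.basis fun _ : Fin N => (EuclideanSpace.basisFun (Fin 3) ℝ).toBasis).ext fun jk => ?_
  rw [Pi.basis_apply, OrthonormalBasis.coe_toBasis, EuclideanSpace.basisFun_apply]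
  simpa using h jk.1 jk.2

/-- **`I_S(P‖Q) = 0` forces `Ψ_P = c Ψ_Q` on `S`.** For `C¹` amplitudes on an open connected
region `S` on which `Ψ_Q ≠ 0`: if the relative Fisher information on `S` vanishes then
`Ψ_P/Ψ_Q` is constant on `S` (the density is continuous, so it vanishes everywhere on `S`; then
`∇(Ψ_P/Ψ_Q) = 0` on the connected open set `S`). [folklore] -/
theorem exists_eq_const_mul_of_relativeFisherInformation_eq_zero {S : Set (Config N)}
    (hS : IsOpen S) (hS' : IsPreconnected S) {ΨP ΨQ : Config N → ℝ} (hP : ContDiff ℝ 1 ΨP)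
    (hQ : ContDiff ℝ 1 ΨQ) (hQ0 : ∀ X ∈ S, ΨQ X ≠ 0)
    (h0 : relativeFisherInformation S ΨP ΨQ = 0) :
    ∃ c : ℝ, ∀ X ∈ S, ΨP X = c * ΨQ X := by
  have hh : ContDiffOn ℝ 1 (fun Y => ΨP Y / ΨQ Y) S := hP.contDiffOn.div hQ.contDiffOn hQ0
  have hhd : DifferentiableOn ℝ (fun Y => ΨP Y / ΨQ Y) S := hh.differentiableOn one_ne_zero
  have hcont : ContinuousOn (fun X => fderiv ℝ (fun Y => ΨP Y / ΨQ Y) X) S :=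
    hh.continuousOn_fderiv_of_isOpen hS le_rfl
  -- the density vanishes almost everywhere on `S`
  have hae : ∀ᵐ X ∂volume, X ∈ S → relFisherDensity ΨP ΨQ X = 0 :=
    (ae_restrict_iff' hS.measurableSet).1
      ((lintegral_eq_zero_iff (measurable_relFisherDensity ΨP hQ.continuous.measurable)).1 h0)
  -- hence every partial derivative of the ratio vanishes on `S`
  have hpart : ∀ X ∈ S, ∀ (i : Fin N) (k : Fin 3),
      fderiv ℝ (fun Y => ΨP Y / ΨQ Y) X (Pi.single i (EuclideanSpace.single k (1 : ℝ))) = 0 := by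
    intro X hX i k
    by_contra hne
    set v : Config N := Pi.single i (EuclideanSpace.single k (1 : ℝ)) with hv
    set U : Set (Config N) := S ∩ (fun Y => fderiv ℝ (fun Y => ΨP Y / ΨQ Y) Y v) ⁻¹' {0}ᶜ with hU
    have hUo : IsOpen U :=
      (hcont.clm_apply continuousOn_const).isOpen_inter_preimage hS isOpen_compl_singleton
    have hUpos : 0 < volume U := hUo.measure_pos volume ⟨X, hX, hne⟩
    have hUzero : volume U = 0 := by
      refine measure_mono_null ?_ (ae_iff.1 hae)
      rintro Y ⟨hYS, hYne⟩ hY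
      apply hYne
      have hd : relFisherDensity ΨP ΨQ Y = 0 := hY hYS
      simp only [relFisherDensity, mul_eq_zero, ENNReal.ofReal_eq_zero, OfNat.ofNat_ne_zero,
        false_or] at hd
      rcases hd with hd | hd
      · have := (Finset.sum_eq_zero_iff.1 hd i (Finset.mem_univ _))
        have := (Finset.sum_eq_zero_iff.1 this k (Finset.mem_univ _))
        simpa using this
      · exact absurd hd (not_le.mpr (pow_pos (lt_of_le_of_ne (abs_nonneg _)
          (Ne.symm (abs_ne_zero.mpr (hQ0 Y hYS)))) 2 |>.trans_eq (sq_abs _)))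
    exact hUpos.ne' hUzero
  have hzero : S.EqOn (fun X => fderiv ℝ (fun Y => ΨP Y / ΨQ Y) X) 0 := fun X hX =>
    clm_eq_zero_of_apply_single_eq_zero _ (hpart X hX)
  obtain ⟨a, ha⟩ := hS.exists_is_const_of_fderiv_eq_zero hS' hhd hzero
  refine ⟨a, fun X hX => ?_⟩
  rw [← ha X hX, div_mul_cancel₀ _ (hQ0 X hX)]

/-- **Characterisation of `I = 0`.** For `C¹` real amplitudes on an open connected region `S`
with `Ψ_Q ≠ 0` on `S`: `I_S(P‖Q) = 0 ↔ ∃ c, Ψ_P = c Ψ_Q on S` (for normalised states of one sign,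
`c = 1`: equality of the measures, the strict positivity of relative Fisher information).
[cite: RezakhanlouVillani2008, Part I §1.3.1 p. 15] -/
theorem relativeFisherInformation_eq_zero_iff {S : Set (Config N)} (hS : IsOpen S)
    (hS' : IsPreconnected S) {ΨP ΨQ : Config N → ℝ} (hP : ContDiff ℝ 1 ΨP) (hQ : ContDiff ℝ 1 ΨQ)
    (hQ0 : ∀ X ∈ S, ΨQ X ≠ 0) :
    relativeFisherInformation S ΨP ΨQ = 0 ↔ ∃ c : ℝ, ∀ X ∈ S, ΨP X = c * ΨQ X :=
  ⟨exists_eq_const_mul_of_relativeFisherInformation_eq_zero hS hS' hP hQ hQ0, fun ⟨_, hc⟩ =>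
    relativeFisherInformation_eq_zero_of_eqOn hS hc hQ0⟩

/-! ### Logarithmic form -/

/-- **Logarithmic form of the density.** Where `Ψ_P, Ψ_Q` are differentiable and non-zero,
`4|∇(Ψ_P/Ψ_Q)|² Ψ_Q² = |∇ log(Ψ_P²/Ψ_Q²)|² Ψ_P²`, i.e. `|∇f|²/f dQ = |∇ log f|² dP` for
`f = dP/dQ = Ψ_P²/Ψ_Q²` — the two classical expressions of `I(P|Q)`.
[cite: RezakhanlouVillani2008, Part I §1.3.1 p. 15] -/
theorem relFisherDensity_eq_log {ΨP ΨQ : Config N → ℝ} {X : Config N}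
    (hP : DifferentiableAt ℝ ΨP X) (hQ : DifferentiableAt ℝ ΨQ X) (hP0 : ΨP X ≠ 0)
    (hQ0 : ΨQ X ≠ 0) :
    relFisherDensity ΨP ΨQ X =
      (∑ i : Fin N, ∑ k : Fin 3, (‖fderiv ℝ (fun Y => Real.log (ΨP Y ^ 2 / ΨQ Y ^ 2)) X
        (Pi.single i (EuclideanSpace.single k (1 : ℝ)))‖₊ : ℝ≥0∞) ^ 2) *
          ENNReal.ofReal (ΨP X ^ 2) := by
  have hh : DifferentiableAt ℝ (fun Y => ΨP Y / ΨQ Y) X := by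
    simp only [div_eq_mul_inv]
    exact hP.mul (hQ.inv hQ0)
  have hhX : ΨP X / ΨQ X ≠ 0 := div_ne_zero hP0 hQ0
  have hg_eq : (fun Y => Real.log (ΨP Y ^ 2 / ΨQ Y ^ 2)) =
      fun Y => Real.log ((ΨP Y / ΨQ Y) * (ΨP Y / ΨQ Y)) := by
    funext Y
    rw [div_mul_div_comm, ← sq, ← sq]
  have hlog : HasFDerivAt (fun Y => Real.log (ΨP Y ^ 2 / ΨQ Y ^ 2))
      ((2 * ΨQ X / ΨP X) • fderiv ℝ (fun Y => ΨP Y / ΨQ Y) X) X := by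
    rw [hg_eq]
    refine ((hh.hasFDerivAt.mul hh.hasFDerivAt).log (mul_ne_zero hhX hhX)).congr_fderiv ?_
    rw [← two_smul ℝ ((ΨP X / ΨQ X) • fderiv ℝ (fun Y => ΨP Y / ΨQ Y) X), smul_smul, smul_smul]
    congr 1
    simp only [Pi.mul_apply]
    field_simp
  rw [hlog.fderiv]
  have e1 : ((‖2 * ΨQ X / ΨP X‖₊ : ℝ≥0∞)) ^ 2 = ENNReal.ofReal ((2 * ΨQ X / ΨP X) ^ 2) := by
    rw [← enorm_eq_nnnorm, Real.enorm_eq_ofReal_abs, ← ENNReal.ofReal_pow (abs_nonneg _), sq_abs]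
  simp only [relFisherDensity, smul_apply, smul_eq_mul, nnnorm_mul, ENNReal.coe_mul, mul_pow,
    ← Finset.mul_sum, e1]
  have key : (2 * ΨQ X / ΨP X) ^ 2 * ΨP X ^ 2 = 4 * ΨQ X ^ 2 := by
    field_simp
    ring
  calc 4 * (∑ i : Fin N, ∑ k : Fin 3, ((‖fderiv ℝ (fun Y => ΨP Y / ΨQ Y) X
          (Pi.single i (EuclideanSpace.single k (1 : ℝ)))‖₊ : ℝ≥0∞)) ^ 2) * ENNReal.ofReal (ΨQ X ^ 2)
        = ENNReal.ofReal (4 * ΨQ X ^ 2) * ∑ i : Fin N, ∑ k : Fin 3, ((‖fderiv ℝ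
            (fun Y => ΨP Y / ΨQ Y) X (Pi.single i (EuclideanSpace.single k (1 : ℝ)))‖₊ :
              ℝ≥0∞)) ^ 2 := by
          rw [ENNReal.ofReal_mul zero_le_four, ENNReal.ofReal_ofNat]
          ring
    _ = _ := by
          rw [← key, ENNReal.ofReal_mul (sq_nonneg _)]
          ring

end Literature.MathematicalPhysics.QuantumManyBody.BoseGas
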